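import Summits.QuantumFields.BalabanUV.T4Continuum.Support.GradedWellBackground

/-!
# T⁴ programme, spine node NE2 (U1a) — THE NAMED Δ1 TARGETS «ROOT GW» / «ROOT GW WITH BACKGROUND» AND THEIR PROOFS: the graded-well (multi-region)
# towers converge at the torus rate for ANY region geometry (`RootGW`, `rootGW_holds`; `RootGWB`, `rootGWB_of_tierBLaws`)

Cell `pub-balaban-gaps` (YM blitz, track G2, seat ne2 = spine estimate NE2; census `run/shared/lean/pub/pub-balaban-gaps/ne/NE2.md`).
Companion of `Spine/NE2/Targets.lean` (the typer's named shapes `TierBLaws` / `RootB` of the single-region resolvent route): after the scope ruling c1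
(T4-DAG §8 Q32) the layers remaining between ROOT B and «NE2⁺ as worded» were carved as sub-rows Δ1 (multi-region {Ω_j} / Dirichlet data [B9]
(3.27)), Δ3 (decay currency), Δ5 (Hessian form).  For Δ1 the parked lineage located print's structure as a GRADED ABSORBER (finest layer outermost;
`t4/T4-EST-NE2-D1-GW-SPEC.md`, owner ruling R47) and reduced its tower END to four leaves; this cell closed the last two ((E4) `GradedWellMassCommutator`,
(GW-B) `GradedWellColumnsTwoLevel`), the junction `GradedWellTowerEnd.towerLimitRate_GW`, and the Δ1 × tier-B composition `GradedWellBackground`.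
THIS FILE gives the results ONE NAME each, in the format of `Targets.RootB`:
 * §1 `CGW`, `RootGW L M m layer a a′ θ` [shape]; **`rootGW_holds (ha) (hd : 1 ≤ d) (hL : 2 ≤ L) (hlay : layer ≤ m) (ha′) : RootGW … L⁻¹`** — NO other
   binder; `rootGW_holds_rate` (any `θ ∈ [L⁻¹, 1)`); `rootGW_holds_zero` (the one-region layer map);
 * §2 `CGWB`, `RootGWB L M m layer a a′ P κ C₂ t` [shape] (the background-perturbed graded-well tower, colour-lifted);
   **`rootGWB_of_tierBLaws (hP : TierBLaws L M a ha P κ C₂) (ht : ‖t‖·κ(1 + ε_GW) < 1) : RootGWB … P κ C₂ t`** — the Δ1 twin of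
   `Targets.rootB_of_tierBLaws` (for Bałaban's typed `P_B` under ROOT B's `hreg`/`hNE3`/smallness: `GradedWellBackground.towerLimitRate_GW_balaban`).

HONEST FRAMING (T4-DAG p. 1).  MODEL LEVEL: ONE layer map on UNIT blocks with `m` FIXED (constants grow like `L^{3m}`; print has `m = k` layers on
`L^jη`-blocks decoupled by (3.42)-type decay — located model delta (δ1), repair R7 of the census), finite torus, operator norm, King's piecewise-constant
pairing; `RootGW` is `U = 1`; `RootGWB` takes the background ONLY through row NE2's typed `TierBLaws` (data `P`, dictionary B0 asserted nowhere, NE3 displayed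
wherever Bałaban's `P_B` is plugged); constants OURS.  NOT [B9] (3.16)/(3.23)–(3.27)/(3.42) as printed; NE2 (U1a) NOT proved — it stays OPEN and ONE label
in the count of nine; spine PROVED 0/9 unchanged; NOT continuum YM, NOT infinite volume / mass gap / Clay.  HONEST DEPENDENCY: continuum YM on T⁴ ⇐
BetaPertH ∧ nine spine estimates (0/9 proved); BetaPertH ⇐ (D1) ∧ (D4) ∧ CAP+tail; G-an2-4 gates asym, D1 and NE2/3/4.  No `sorry`; the only `def`s are
the constants `CGW`/`CGWB` and the [shape]s `RootGW`/`RootGWB` (parametric propositions, NOT facts).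
-/

noncomputable section

open scoped BigOperators ComplexConjugate Matrix Matrix.Norms.L2Operator Kronecker

namespace Summit.QuantumFields.BalabanUV.T4Continuum.NE2.RegionsGradedWell

open Literature.MathematicalPhysics.QuantumFieldTheory.Balaban1983to89.B5Prop11Plancherel (Tor fine Cst)
open Literature.MathematicalPhysics.QuantumFieldTheory.Balaban1983to89.B5G183RateUnitTower (lev lev_neZero)
open Summit.QuantumFields.BalabanUV.T4Continuum
open Summit.QuantumFields.BalabanUV.T4Continuum.CovariantAveragingTower (TowerLimitRate)
open Summit.QuantumFields.BalabanUV.T4Continuum.BackgroundResolventTower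
open Summit.QuantumFields.BalabanUV.T4Continuum.BalabanAveragedTowerUnit (idx Qlev)
open Summit.QuantumFields.BalabanUV.T4Continuum.KingPairingPlantedLaw (JpcT)
open Summit.QuantumFields.BalabanUV.T4Continuum.GradedWellData
open Summit.QuantumFields.BalabanUV.T4Continuum.GradedWellGram (sigGW)
open Summit.QuantumFields.BalabanUV.T4Continuum.GradedWellConsistencyTransfer (C1Tc C2GW)
open Summit.QuantumFields.BalabanUV.T4Continuum.GradedWellSandwichLaw (CSGW)
open Summit.QuantumFields.BalabanUV.T4Continuum.GradedWellDifference (eGW)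
open Summit.QuantumFields.BalabanUV.T4Continuum.GradedWellTowerCoercive (gamGWv)
open Summit.QuantumFields.BalabanUV.T4Continuum.GradedWellMassCommutator (CMGW)
open Summit.QuantumFields.BalabanUV.T4Continuum.GradedWellColumnsTwoLevel (CbGW)
open Summit.QuantumFields.BalabanUV.T4Continuum.GradedWellTowerEnd (towerLimitRate_GW towerLimitRate_GW_rate)
open Summit.QuantumFields.BalabanUV.T4Continuum.NE2.Targets (TierBLaws)
open Summit.QuantumFields.BalabanUV.T4Continuum.GradedWellBackground (epsGW towerLimitRate_GW_of_tierB)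

variable {d : ℕ} {o : Type*} [Fintype o] [DecidableEq o] (L : ℕ) [NeZero L] (M : Fin d → ℕ) [hM : ∀ μ, NeZero (M μ)] (m : ℕ) (layer : Tor M → ℕ)
  (a a' : ℝ)

/-! ## §1 ROOT GW (U = 1) -/

/-- THE CONSTANT of the graded-well root at rate `θ` (re-based at level `m`): `Cpert 0 C₀θ^m C₁θ^m 0 0 0` with the explicit `C₀`, `C₁` of
`GradedWellTowerEnd.towerLimitRate_GW` (functions of `d, L, m, a, a′`). [folklore] -/
def CGW (d L m : ℕ) (a a' θ : ℝ) : ℝ :=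
  Cpert 0 ((1 + (gamGWv d L m a a')⁻¹ * eGW d L m a a') * (2 * d * Cst d a) * θ ^ m)
    (C1Tc d a (gamGWv d L m a a') (eGW d L m a a')
      (C2GW d L a (Cst d a ^ 2 * CMGW L m) (Cst d a ^ 2 * CSGW d L m a' (CbGW d L m a'))) * θ ^ m) 0 0 0

/-- [shape] **ROOT GW AT RATE `θ`** — the Δ1 (multi-region) analogue of `NE2.Targets.RootB` at `U = 1`: the King-averaged unit-lattice images of
the GRADED-WELL propagators `G_GW(m+k) = (curlᴴcurl + ∂R_GW∂ᴴ + a·Q_GWᴴQ_GW)⁻¹` (print's graded absorber [B9] (3.16)/(3.24)–(3.26) for the region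
geometry encoded by ANY layer map `layer : Tor M → ℕ` with `layer ≤ m`, finest layer outermost, typed on the torus) converge with rate `θ` and the
constant `CGW d L m a a′ θ` (`TowerLimitRate`: ∃ limit, `Tendsto` ∧ `‖avgTow k − lim‖ ≤ C·θ^k/(1 − θ)`).  A parametric definition of a proposition —
NOT a fact. [cite: Balaban1985BackgroundPropagators, (3.16) p.393, (3.24)–(3.27) pp.394–395 (shapes)] [folklore] -/
def RootGW (θ : ℝ) : Prop :=
  TowerLimitRate (ι := fun k => idx L M (m + k)) (fun k => Qlev L M (m + k)) ((L : ℝ) ^ d)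
    (fun k => (regionGW L M (m + k) m layer a a')⁻¹) (CGW d L m a a' θ) θ

/-- **ROOT GW HOLDS AT THE TORUS RATE `L⁻¹`** for every `1 ≤ d`, `2 ≤ L`, layer map `layer ≤ m`, `0 < a`, `0 < a′` — NO other binder
(`GradedWellTowerEnd.towerLimitRate_GW` BY NAME).  MODEL LEVEL (`U = 1`, `m` fixed, unit blocks, finite torus, operator norm); NOT [B9] as printed;
NE2 (U1a) NOT proved by this; spine PROVED 0/9 unchanged. [folklore] -/
theorem rootGW_holds (ha : 0 < a) (hd : 1 ≤ d) (hL : 2 ≤ L) (hlay : ∀ y, layer y ≤ m) (ha' : 0 < a') :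
    RootGW L M m layer a a' ((L : ℝ)⁻¹) :=
  towerLimitRate_GW L M m layer a a' ha hd hL hlay ha'

/-- **… AND AT ANY GEOMETRIC RATE `θ ∈ [L⁻¹, 1)`** (the spine's Cauchy sum `T4CauchySum.GeomRate` accepts any `θ < 1`). [folklore] -/
theorem rootGW_holds_rate (ha : 0 < a) (hd : 1 ≤ d) (hL : 2 ≤ L) (hlay : ∀ y, layer y ≤ m) (ha' : 0 < a') {θ : ℝ}
    (hθ : (L : ℝ)⁻¹ ≤ θ) (hθ1 : θ < 1) : RootGW L M m layer a a' θ :=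
  towerLimitRate_GW_rate L M m layer a a' ha hd hL hlay ha' hθ hθ1

/-- the root at the trivial layer map (one region, `m = 0`: the whole torus is the carrier) — a non-vacuity witness of the shape's data. [folklore] -/
theorem rootGW_holds_zero (ha : 0 < a) (hd : 1 ≤ d) (hL : 2 ≤ L) (ha' : 0 < a') :
    RootGW L M 0 (fun _ => 0) a a' ((L : ℝ)⁻¹) :=
  rootGW_holds L M 0 (fun _ => 0) a a' ha hd hL (fun _ => le_rfl) ha'


/-! ## §2 ROOT GW WITH BACKGROUND (Δ1 × tier B) -/

/-- THE CONSTANT of the background root over the graded well at coupling `t` (re-based at level `m`). [folklore] -/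
def CGWB (d L m : ℕ) (a a' κ C₂ : ℝ) (t : ℂ) : ℝ :=
  Cpert (κ * (1 + epsGW d L m a a'))
    ((1 + (gamGWv d L m a a')⁻¹ * eGW d L m a a') * (2 * d * Cst d a) * ((L : ℝ)⁻¹) ^ m)
    (C1Tc d a (gamGWv d L m a a') (eGW d L m a a')
      (C2GW d L a (Cst d a ^ 2 * CMGW L m) (Cst d a ^ 2 * CSGW d L m a' (CbGW d L m a'))) * ((L : ℝ)⁻¹) ^ m)
    ((1 + epsGW d L m a a') ^ 2 * (C₂ * ((L : ℝ)⁻¹) ^ m)) 0 t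

/-- [shape] **ROOT GW WITH BACKGROUND AT COUPLING `t`** — the Δ1 analogue of `NE2.Targets.RootB`: the King-averaged colour-lifted unit-lattice images of
`((Δ_GW(m+k) ⊗ 1) + t·P_{m+k})⁻¹` converge with rate `L⁻¹` and the constant `CGWB`.  A parametric definition of a proposition — NOT a fact. [folklore] -/
def RootGWB (P : (k : ℕ) → Matrix (idx L M k × o) (idx L M k × o) ℂ) (κ C₂ : ℝ) (t : ℂ) : Prop :=
  TowerLimitRate (ι := fun k => idx L M (m + k) × o) (fun k => Qlev L M (m + k) ⊗ₖ (1 : Matrix o o ℂ)) ((L : ℝ) ^ d)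
    (fun k => (regionGW L M (m + k) m layer a a' ⊗ₖ (1 : Matrix o o ℂ) + t • P (m + k))⁻¹) (CGWB d L m a a' κ C₂ t) ((L : ℝ)⁻¹)

/-- **`TierBLaws ⟹ RootGWB`** (`1 ≤ d`, `2 ≤ L`, `layer ≤ m`, `0 < a`, `0 < a′`, `‖t‖·κ(1 + ε_GW) < 1`) — the Δ1 twin of `NE2.Targets.rootB_of_tierBLaws`:
row NE2's ONE typed hypothesis against `Δ_a ⊗ 1` gives the background-perturbed tower over the GRADED WELL too, for any region geometry
(`GradedWellBackground.towerLimitRate_GW_of_tierB`; for Bałaban's typed `P_B` under `hreg`/`hNE3`/smallness: `GradedWellBackground.towerLimitRate_GW_balaban`).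
MODEL LEVEL; NE2 (U1a) NOT proved; spine PROVED 0/9 unchanged. [folklore] -/
theorem rootGWB_of_tierBLaws (ha : 0 < a) (hd : 1 ≤ d) (hL : 2 ≤ L) (hlay : ∀ y, layer y ≤ m) (ha' : 0 < a')
    {P : (k : ℕ) → Matrix (idx L M k × o) (idx L M k × o) ℂ} {κ C₂ : ℝ} (hP : TierBLaws L M a ha P κ C₂)
    {t : ℂ} (ht : ‖t‖ * (κ * (1 + epsGW d L m a a')) < 1) : RootGWB L M m layer a a' P κ C₂ t :=
  towerLimitRate_GW_of_tierB L M m layer a a' o ha hd hL hlay ha' hP ht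

end Summit.QuantumFields.BalabanUV.T4Continuum.NE2.RegionsGradedWell

end
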